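import Summits.HubbardSuperconductivity.HubbardSuperconductivity.Theorems.NodalDiracTwistBridgeNodalToDWaveDiracBlockLimit

/-!
# Route `NodalDiracTwist`, crux `BridgeNodalToDWave` (stmt-HubbardSuperconductivity-10395) —
# helper: holonomy `−1` points are crossings INSIDE a symmetry block

Line `birth`, lead c11 (`--supports stmt-HubbardSuperconductivity-10395`).  Abstract form of lead
c9's audit item S3 (second half): let `V` be a subspace of Fock space invariant under every
`H_L(U,φ)` and under the antiunitary `T = F ∘ K`, and suppose that on a punctured closed disk about
`p` the `(N, S^z = 0)` sector ground state of `H_L(U,φ)` is unique and LIES IN `V`, while around the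
boundary circle the cyclic overlap product of unit sector ground states is eventually NEGATIVE
(holonomy `−1`, clause (II) of the nodal-Dirac package).  Then the sector ground space AT `p`
contains an ORTHOGONAL PAIR inside `V` (`exists_orthogonal_pair_in_block`, registered sub-goal
`stub_orthogonalPairInBlock`): the degeneracy certified by the holonomy is a crossing within the
block `V`, not a touching of a foreign block.  Proof: otherwise the sub-sector `K' = K ⊓ V` has a
UNIQUE ground state on the whole closed disk (off `p` its ground states are the sector ground
states, which lie in `V`; at `p` a limit of them lies in `V`, `exists_groundState_at_limit`, and two
would give the forbidden pair), so the abstract trivial-holonomy theorem `re_prod_cyclicOverlap_pos`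
of the route's `DiskTrivialHolonomy` apparatus, applied to `K'`, makes the same cyclic overlap
product eventually POSITIVE — a contradiction.  The intended `V` is a joint eigenspace of the
lattice translations (momentum block), see `…DiracIntraBlockMomentum`.

Sources: Y. Hatsugai, J. Phys. Soc. Jpn. 75 (2006) 123601; T. Fukui, Y. Hatsugai, H. Suzuki,
J. Phys. Soc. Jpn. 74 (2005) 1674; T. Kato (1966) II §5.1.  No new definitions, no named facts.
-/

-- the mandated namespace `Summit.<Summit>.<Problem>.Theorems` repeats `HubbardSuperconductivity`
set_option linter.dupNamespace false

noncomputable section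

namespace Summit.HubbardSuperconductivity.HubbardSuperconductivity.Theorems.NodalDiracTwist.BridgeNodalToDWave

open Matrix Filter Topology Literature.MathematicalPhysics.QuantumLattice Literature.Probability.LatticeModels HubbardWave0
open Summit.HubbardSuperconductivity.HubbardSuperconductivity.Theorems.NodalDiracTwist
open scoped ComplexOrder

variable (L : ℕ) [NeZero L]

/-- **Holonomy `−1` points are crossings inside an invariant block.**  See the file header.
Hatsugai (2006); Fukui–Hatsugai–Suzuki (2005). [folklore] -/
theorem exists_orthogonal_pair_in_block (U : ℝ) (N : ℕ)
    (V : Submodule ℂ (Fock (Orb (FermionTorus 2 L))))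
    (hVH : ∀ (φ : Fin 2 → ℝ) (χ : Fock (Orb (FermionTorus 2 L))), χ ∈ V →
      spinTwistedHubbardTorus L U φ *ᵥ χ ∈ V)
    (hVT : ∀ χ ∈ V, (fockRelabel (Orb.spinSwap : Orb (FermionTorus 2 L) ≃ Orb (FermionTorus 2 L))).val *ᵥ
      star χ ∈ V)
    (p : Fin 2 → ℝ) {r : ℝ} (hr : 0 < r)
    (hexp : ∃ χ, IsGroundStateInSector (spinTwistedHubbardTorus L U p) N 0 χ)
    (huniq : ∀ φ : Fin 2 → ℝ, (φ 0 - p 0) ^ 2 + (φ 1 - p 1) ^ 2 ≤ r ^ 2 → φ ≠ p →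
      ∀ χ₁ χ₂ : Fock (Orb (FermionTorus 2 L)),
      IsGroundStateInSector (spinTwistedHubbardTorus L U φ) N 0 χ₁ →
      IsGroundStateInSector (spinTwistedHubbardTorus L U φ) N 0 χ₂ → ∃ z : ℂ, χ₂ = z • χ₁)
    (hinV : ∀ φ : Fin 2 → ℝ, (φ 0 - p 0) ^ 2 + (φ 1 - p 1) ^ 2 ≤ r ^ 2 → φ ≠ p →
      ∀ χ, IsGroundStateInSector (spinTwistedHubbardTorus L U φ) N 0 χ → χ ∈ V)
    (hHOL : ∃ n₀ : ℕ, ∀ n ≥ n₀, ∀ ψ : Fin n → Fock (Orb (FermionTorus 2 L)),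
      (∀ i : Fin n, IsGroundStateInSector (spinTwistedHubbardTorus L U (fun ν : Fin 2 => p ν + r *
        (if ν = 0 then Real.cos (2 * Real.pi * (i : ℕ) / n)
          else Real.sin (2 * Real.pi * (i : ℕ) / n)))) N 0 (ψ i) ∧ star (ψ i) ⬝ᵥ ψ i = 1) →
      (∏ i : Fin n, star (ψ i) ⬝ᵥ ψ (finRotate n i)).re < 0) :
    ∃ χ₁ χ₂ : Fock (Orb (FermionTorus 2 L)),
      IsGroundStateInSector (spinTwistedHubbardTorus L U p) N 0 χ₁ ∧
      IsGroundStateInSector (spinTwistedHubbardTorus L U p) N 0 χ₂ ∧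
      star χ₁ ⬝ᵥ χ₂ = 0 ∧ χ₁ ∈ V ∧ χ₂ ∈ V := by
  classical
  by_contra hno
  -- the sector is nonempty: existence of sector ground states and the variational bound
  have hp : ∃ s : Finset (Orb (FermionTorus 2 L)), s.card = N ∧ (upPart s).card = (downPart s).card := by
    by_contra hp
    push Not at hp
    obtain ⟨χ, hmem, hne, -⟩ := hexp
    exact hne (funext fun s => (mem_szSector_zero_iff_coord N _).1 hmem s fun h => hp s h.1 h.2)
  have hsg := fun φ : Fin 2 → ℝ => sector_groundState (spinTwistedHubbardTorus L U φ)
    (spinTwistedHubbardTorus_isHermitian L U φ)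
    (fun s : Finset (Orb (FermionTorus 2 L)) => s.card = N ∧ (upPart s).card = (downPart s).card)
    hp (fun s s' hs hs' => spinTwistedHubbardTorus_apply_eq_zero L U φ N s s' hs hs')
    (szSector N 0) (mem_szSector_zero_iff_coord N)
  -- unit sector ground states exist everywhere
  have hunit : ∀ φ : Fin 2 → ℝ, ∃ χ, IsGroundStateInSector (spinTwistedHubbardTorus L U φ) N 0 χ ∧
      star χ ⬝ᵥ χ = 1 := fun φ => by
    obtain ⟨⟨v, hvK, hv0, hv⟩, -⟩ := hsg φ
    obtain ⟨c, hc, hc1⟩ := exists_smul_unit hv0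
    exact ⟨c • v, isGroundStateInSector_smul ⟨hvK, hv0, hv⟩ hc, hc1⟩
  set K' : Submodule ℂ (Fock (Orb (FermionTorus 2 L))) := szSector N 0 ⊓ V with hK'
  have hK'K : K' ≤ szSector N 0 := inf_le_left
  -- (a) a unit sector ground state at `p` inside `V`, as a limit along `φ_n = p + (r/(n+1)) e₀`
  set φs : ℕ → (Fin 2 → ℝ) := fun n i => if i = 0 then p 0 + r / ((n : ℝ) + 1) else p 1 with hφs
  have hφs0 : ∀ n, φs n 0 = p 0 + r / ((n : ℝ) + 1) := fun n => by simp [hφs]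
  have hφs1 : ∀ n, φs n 1 = p 1 := fun n => by simp [hφs]
  have hφD : ∀ n, (φs n 0 - p 0) ^ 2 + (φs n 1 - p 1) ^ 2 ≤ r ^ 2 := fun n => by
    rw [hφs0, hφs1, add_sub_cancel_left, sub_self]
    have h1 : 0 ≤ r / ((n : ℝ) + 1) := by positivity
    have h2 : r / ((n : ℝ) + 1) ≤ r := div_le_self hr.le (by linarith [n.cast_nonneg (α := ℝ)])
    nlinarith
  have hφne : ∀ n, φs n ≠ p := fun n h => by
    have h0 := congrFun h 0
    rw [hφs0, add_eq_left] at h0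
    exact absurd h0 (by positivity)
  have hφp : Tendsto φs atTop (𝓝 p) := by
    rw [tendsto_pi_nhds]
    intro i
    fin_cases i
    · simp only [hφs, Fin.zero_eta, Fin.isValue, ↓reduceIte]
      have h := (tendsto_one_div_add_atTop_nhds_zero_nat.const_mul r).const_add (p 0)
      simp only [mul_zero, add_zero] at h
      refine h.congr' (Eventually.of_forall fun n => ?_)
      simp only [mul_one_div]
    · simp only [hφs, Fin.mk_one, Fin.isValue, one_ne_zero, ↓reduceIte]
      exact tendsto_const_nhds
  choose χs hχs using fun n => hunit (φs n)
  obtain ⟨χstar, hGSstar, h1star, hVstar⟩ := exists_groundState_at_limit L U N p hr.le (V : Set _)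
    V.closed_of_finiteDimensional φs hφD hφp χs (fun n => (hχs n).1) (fun n => (hχs n).2)
    (fun n => hinV (φs n) (hφD n) (hφne n) _ (hχs n).1)
  -- (b)+(c) the `K'`-ground states on the disk are the sector ground states in `V`
  have hGS' : ∀ φ : Fin 2 → ℝ, (φ 0 - p 0) ^ 2 + (φ 1 - p 1) ^ 2 ≤ r ^ 2 → ∀ ξ,
      (ξ ∈ K' ∧ ξ ≠ 0 ∧ spinTwistedHubbardTorus L U φ *ᵥ ξ =
        (((spinTwistedHubbardTorus L U φ).minEnergyOn K' : ℝ) : ℂ) • ξ) ↔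
      (ξ ∈ K' ∧ IsGroundStateInSector (spinTwistedHubbardTorus L U φ) N 0 ξ) := by
    intro φ hφ ξ
    obtain ⟨χ, hχK', hχ1, hχeig⟩ : ∃ χ, χ ∈ K' ∧ star χ ⬝ᵥ χ = 1 ∧ spinTwistedHubbardTorus L U φ *ᵥ χ =
        (((spinTwistedHubbardTorus L U φ).minEnergyOn (szSector N 0) : ℝ) : ℂ) • χ := by
      by_cases hφp : φ = p
      · subst hφp
        exact ⟨χstar, ⟨hGSstar.1, hVstar⟩, h1star, hGSstar.2.2⟩
      · obtain ⟨χ, hχ, hχ1⟩ := hunit φ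
        exact ⟨χ, ⟨hχ.1, hinV φ hφ hφp χ hχ⟩, hχ1, hχ.2.2⟩
    exact groundState_inf_iff (spinTwistedHubbardTorus_isHermitian L U φ) hK'K (hsg φ).2 hχK' hχ1 hχeig ξ
  -- (d) uniqueness of the `K'`-ground state on the closed disk
  have huniq' : ∀ φ : Fin 2 → ℝ, (φ 0 - p 0) ^ 2 + (φ 1 - p 1) ^ 2 ≤ r ^ 2 →
      ∀ χ₁ χ₂ : Fock (Orb (FermionTorus 2 L)),
      (χ₁ ∈ K' ∧ χ₁ ≠ 0 ∧ spinTwistedHubbardTorus L U φ *ᵥ χ₁ =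
        (((spinTwistedHubbardTorus L U φ).minEnergyOn K' : ℝ) : ℂ) • χ₁) →
      (χ₂ ∈ K' ∧ χ₂ ≠ 0 ∧ spinTwistedHubbardTorus L U φ *ᵥ χ₂ =
        (((spinTwistedHubbardTorus L U φ).minEnergyOn K' : ℝ) : ℂ) • χ₂) → ∃ z : ℂ, χ₂ = z • χ₁ := by
    intro φ hφ χ₁ χ₂ h₁ h₂
    rw [hGS' φ hφ] at h₁ h₂
    by_cases hφp : φ = p
    · subst hφp
      -- Gram–Schmidt inside `V`
      obtain ⟨⟨-, hV₁⟩, hmem₁, hne₁, heig₁⟩ := h₁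
      obtain ⟨⟨-, hV₂⟩, hmem₂, -, heig₂⟩ := h₂
      have h11 : star χ₁ ⬝ᵥ χ₁ ≠ 0 := fun h => hne₁ (dotProduct_star_self_eq_zero.1 h)
      refine ⟨star χ₁ ⬝ᵥ χ₂ / star χ₁ ⬝ᵥ χ₁, ?_⟩
      have hηmem : χ₂ - (star χ₁ ⬝ᵥ χ₂ / star χ₁ ⬝ᵥ χ₁) • χ₁ ∈ szSector N 0 :=
        Submodule.sub_mem _ hmem₂ (Submodule.smul_mem _ _ hmem₁)
      have hηV : χ₂ - (star χ₁ ⬝ᵥ χ₂ / star χ₁ ⬝ᵥ χ₁) • χ₁ ∈ V :=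
        Submodule.sub_mem _ hV₂ (Submodule.smul_mem _ _ hV₁)
      have hηeig : spinTwistedHubbardTorus L U φ *ᵥ (χ₂ - (star χ₁ ⬝ᵥ χ₂ / star χ₁ ⬝ᵥ χ₁) • χ₁) =
          (((spinTwistedHubbardTorus L U φ).minEnergyOn (szSector N 0) : ℝ) : ℂ) •
            (χ₂ - (star χ₁ ⬝ᵥ χ₂ / star χ₁ ⬝ᵥ χ₁) • χ₁) := by
        rw [Matrix.mulVec_sub, Matrix.mulVec_smul, heig₁, heig₂, smul_sub,
          smul_comm (star χ₁ ⬝ᵥ χ₂ / star χ₁ ⬝ᵥ χ₁)]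
      have hηorth : star χ₁ ⬝ᵥ (χ₂ - (star χ₁ ⬝ᵥ χ₂ / star χ₁ ⬝ᵥ χ₁) • χ₁) = 0 := by
        rw [dotProduct_sub, dotProduct_smul, smul_eq_mul, div_mul_cancel₀ _ h11, sub_self]
      by_contra hne
      exact hno ⟨χ₁, _, ⟨hmem₁, hne₁, heig₁⟩, ⟨hηmem, fun h => hne (sub_eq_zero.1 h), hηeig⟩, hηorth,
        hV₁, hηV⟩
    · exact huniq φ hφ hφp χ₁ χ₂ h₁.2 h₂.2
  -- (e) the abstract trivial-holonomy theorem on `K'`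
  have hK'A : ∀ (φ : Fin 2 → ℝ), ∀ v ∈ K', spinTwistedHubbardTorus L U φ *ᵥ v ∈ K' := fun φ v hv =>
    ⟨spinTwistedHubbardTorus_mulVec_mem_szSector L U φ hv.1, hVH φ v hv.2⟩
  have hK'ne : K' ≠ ⊥ := by
    rw [Submodule.ne_bot_iff]
    exact ⟨χstar, ⟨hGSstar.1, hVstar⟩, hGSstar.2.1⟩
  have hlb' : ∀ (φ : Fin 2 → ℝ), ∀ v ∈ K', star v ⬝ᵥ v = 1 →
      (spinTwistedHubbardTorus L U φ).minEnergyOn K' ≤ (star v ⬝ᵥ spinTwistedHubbardTorus L U φ *ᵥ v).re :=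
    fun φ v hv h1 => minEnergyOn_le_rayleigh_of_mem (spinTwistedHubbardTorus_isHermitian L U φ) K' hv h1
  have hex' : ∀ φ : Fin 2 → ℝ, ∃ v ∈ K', v ≠ 0 ∧ spinTwistedHubbardTorus L U φ *ᵥ v =
      (((spinTwistedHubbardTorus L U φ).minEnergyOn K' : ℝ) : ℂ) • v := fun φ => by
    obtain ⟨ψ, hψ, h1, he⟩ := exists_unit_eigen_minEnergyOn (spinTwistedHubbardTorus_isHermitian L U φ) K'
      (hK'A φ) hK'ne
    exact ⟨ψ, hψ, ne_zero_of_unit h1, he⟩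
  set F := (fockRelabel (Orb.spinSwap : Orb (FermionTorus 2 L) ≃ Orb (FermionTorus 2 L))).val with hF
  have hTs : ∀ (c : ℂ) (v : Fock (Orb (FermionTorus 2 L))), F *ᵥ star (c • v) = star c • (F *ᵥ star v) :=
    fun c v => by rw [star_smul, mulVec_smul]
  have hTK : ∀ v ∈ K', F *ᵥ star v ∈ K' := fun v hv =>
    ⟨fockRelabel_spinSwap_mulVec_mem_szSector
      (Summit.HubbardSuperconductivity.HubbardSuperconductivity.Theorems.NodalDiracTwist.star_mem_szSector hv.1),
      hVT v hv.2⟩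
  have hTH : ∀ (φ : Fin 2 → ℝ) (v : Fock (Orb (FermionTorus 2 L))),
      F *ᵥ star (spinTwistedHubbardTorus L U φ *ᵥ v) = spinTwistedHubbardTorus L U φ *ᵥ (F *ᵥ star v) :=
    fun φ v => fockRelabel_spinSwap_mulVec_star_mulVec L U φ v
  have hTd : ∀ u v : Fock (Orb (FermionTorus 2 L)), star (F *ᵥ star u) ⬝ᵥ (F *ᵥ star v) = star (star u ⬝ᵥ v) :=
    fun u v => by
      rw [hF, star_fockRelabel_mulVec_dotProduct_fockRelabel_mulVec, star_star, dotProduct_star, dotProduct_comm]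
  obtain ⟨n₁, hn₁⟩ := re_prod_cyclicOverlap_pos K' (spinTwistedHubbardTorus L U)
    (continuous_spinTwistedHubbardTorus L U) hlb' hex'
    (fun φ χ => χ ∈ K' ∧ χ ≠ 0 ∧ spinTwistedHubbardTorus L U φ *ᵥ χ =
      (((spinTwistedHubbardTorus L U φ).minEnergyOn K' : ℝ) : ℂ) • χ)
    (fun _ _ => Iff.rfl) (fun v => F *ᵥ star v) hTs hTK hTH hTd p hr huniq'
  obtain ⟨n₀, hn₀⟩ := hHOL
  -- (f) the loop of unit sector ground states is a loop of `K'`-ground states: `Re ∏ < 0 < Re ∏`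
  have hloop : ∀ (n : ℕ) (i : Fin n), ∃ ψ, IsGroundStateInSector (spinTwistedHubbardTorus L U
      (fun ν : Fin 2 => p ν + r * (if ν = 0 then Real.cos (2 * Real.pi * (i : ℕ) / n)
        else Real.sin (2 * Real.pi * (i : ℕ) / n)))) N 0 ψ ∧ star ψ ⬝ᵥ ψ = 1 := fun n i => hunit _
  choose ψ hψ using hloop (max n₀ n₁)
  have hneg := hn₀ (max n₀ n₁) (le_max_left _ _) ψ hψ
  have hpos := hn₁ (max n₀ n₁) (le_max_right _ _) ψ fun i => by
    refine ⟨?_, (hψ i).2⟩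
    rw [hGS' _ (loopPoint_mem_disk p r _)]
    exact ⟨⟨(hψ i).1.1, hinV _ (loopPoint_mem_disk p r _) (loopPoint_ne_center p _ hr) _ (hψ i).1⟩,
      (hψ i).1⟩
  linarith

/-- **Registered sub-goal `stub_orthogonalPairInBlock` of crux stmt-HubbardSuperconductivity-10395**
(lead c11, line `birth`; structural input to stub C): the statement of
`exists_orthogonal_pair_in_block` with all binders explicit and all names fully qualified.
Hatsugai (2006); Fukui–Hatsugai–Suzuki (2005). [folklore] -/
theorem stub_orthogonalPairInBlock : ∀ (L : ℕ) [NeZero L] (U : ℝ) (N : ℕ) (V : Submodule ℂ (Literature.MathematicalPhysics.QuantumLattice.Fock (Literature.MathematicalPhysics.QuantumLattice.Orb (Literature.MathematicalPhysics.QuantumLattice.FermionTorus 2 L)))), (∀ (φ : Fin 2 → ℝ) (χ : Literature.MathematicalPhysics.QuantumLattice.Fock (Literature.MathematicalPhysics.QuantumLattice.Orb (Literature.MathematicalPhysics.QuantumLattice.FermionTorus 2 L))), χ ∈ V → Matrix.mulVec (Literature.MathematicalPhysics.QuantumLattice.spinTwistedHubbardTorus L U φ) χ ∈ V) → (∀ χ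 ∈ V, Matrix.mulVec (Literature.MathematicalPhysics.QuantumLattice.fockRelabel (Literature.MathematicalPhysics.QuantumLattice.Orb.spinSwap : Literature.MathematicalPhysics.QuantumLattice.Orb (Literature.MathematicalPhysics.QuantumLattice.FermionTorus 2 L) ≃ Literature.MathematicalPhysics.QuantumLattice.Orb (Literature.MathematicalPhysics.QuantumLattice.FermionTorus 2 L))).val (star χ) ∈ V) → ∀ (p : Fin 2 → ℝ) (r : ℝ), 0 < r → (∃ χ, Literature.MathematicalPhysics.QuantumLattice.IsGroundStateInSector (Literature.MathematicalPhysics.QuantumLattice.spinTwistedHubbardTorus L U p) N 0 χ) → (∀ φ : Fin 2 → ℝ, (φ 0 - p 0) ^ 2 + (φ 1 - p 1) ^ 2 ≤ r ^ 2 → φ ≠ p → ∀ χ₁ χ₂ : Literature.MathematicalPhysics.QuantumLattice.Fock (Literature.MathematicalPhysics.QuantumLattice.Orb (Literature.MathematicalPhysics.QuantumLattice.FermionTorus 2 L)), Literature.MathematicalPhysics.QuantumLattice.IsGroundStateInSector (Literature.MathematicalPhysics.QuantumLattice.spinTwistedHubbardTorus L U φ) N 0 χ₁ → Literature.MathematicalPhysics.QuantumLattice.IsGroundStateInSector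 (Literature.MathematicalPhysics.QuantumLattice.spinTwistedHubbardTorus L U φ) N 0 χ₂ → ∃ z : ℂ, χ₂ = z • χ₁) → (∀ φ : Fin 2 → ℝ, (φ 0 - p 0) ^ 2 + (φ 1 - p 1) ^ 2 ≤ r ^ 2 → φ ≠ p → ∀ χ : Literature.MathematicalPhysics.QuantumLattice.Fock (Literature.MathematicalPhysics.QuantumLattice.Orb (Literature.MathematicalPhysics.QuantumLattice.FermionTorus 2 L)), Literature.MathematicalPhysics.QuantumLattice.IsGroundStateInSector (Literature.MathematicalPhysics.QuantumLattice.spinTwistedHubbardTorus L U φ) N 0 χ → χ ∈ V) → (∃ n₀ : ℕ, ∀ n ≥ n₀, ∀ ψ : Fin n → Literature.MathematicalPhysics.QuantumLattice.Fock (Literature.MathematicalPhysics.QuantumLattice.Orb (Literature.MathematicalPhysics.QuantumLattice.FermionTorus 2 L)), (∀ i : Fin n, Literature.MathematicalPhysics.QuantumLattice.IsGroundStateInSector (Literature.MathematicalPhysics.QuantumLattice.spinTwistedHubbardTorus L U (fun ν : Fin 2 => p ν + r * (if ν = 0 then Real.cos (2 * Real.pi * (i : ℕ) / n) else Real.sin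 (2 * Real.pi * (i : ℕ) / n)))) N 0 (ψ i) ∧ star (ψ i) ⬝ᵥ ψ i = 1) → (∏ i : Fin n, star (ψ i) ⬝ᵥ ψ (finRotate n i)).re < 0) → ∃ χ₁ χ₂ : Literature.MathematicalPhysics.QuantumLattice.Fock (Literature.MathematicalPhysics.QuantumLattice.Orb (Literature.MathematicalPhysics.QuantumLattice.FermionTorus 2 L)), Literature.MathematicalPhysics.QuantumLattice.IsGroundStateInSector (Literature.MathematicalPhysics.QuantumLattice.spinTwistedHubbardTorus L U p) N 0 χ₁ ∧ Literature.MathematicalPhysics.QuantumLattice.IsGroundStateInSector (Literature.MathematicalPhysics.QuantumLattice.spinTwistedHubbardTorus L U p) N 0 χ₂ ∧ star χ₁ ⬝ᵥ χ₂ = 0 ∧ χ₁ ∈ V ∧ χ₂ ∈ V :=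
  fun L _ U N V hVH hVT p _ hr hexp huniq hinV hHOL =>
    exists_orthogonal_pair_in_block L U N V hVH hVT p hr hexp huniq hinV hHOL

end Summit.HubbardSuperconductivity.HubbardSuperconductivity.Theorems.NodalDiracTwist.BridgeNodalToDWave

end
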